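import Literature.MathematicalPhysics.KineticTheory.HardSphereEuler

/-!
# Objects of the shadowing estimate (line `log-lipschitz-budget`, crux `PolynomialCompression`, stub 4)

Definitions file (reviewed) for the proof of `stub_logBudgetShadowing` of the crux
`ImplosionDichotomy.PolynomialCompression` (stmt-AtomisticToContinuum-12587), blueprint
`Cruxes/PolynomialCompression/Lines/log-lipschitz-budget-stub4.md`. A σ-solution `(ρ, u, θ)` of the
hard-sphere Euler system with pressure law `ρ θ ζ(ρ)` is compared with a reference solution
`(ρ₁, u₁, θ₁)`; the difference `δV = (ρ − ρ₁, u − u₁, θ − θ₁)` is measured in the WEIGHTED `L²` energies of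
its spatial derivatives of order `k ≤ 3`, with the Friedrichs weights of the σ-solution
`A = θ γ(ρ)/ρ` (`γ = ζ + ρ ζ'`) for the density component, `ρ` for the velocity, `B = 3ρ/(2θ)` for the
temperature. This file only NAMES these objects so that the level-by-level estimates (many files) and
the closing bootstrap argument state literally the same hypotheses and conclusions:

* `shadowWeightA`, `shadowWeightB` — the weights;
* `shadowE0`, `shadowE1`, `shadowE2`, `shadowE3` — the level energies `E_k(s) = ∫_{𝕋³} e_k(s, x) dx`
  (`e_k` = sum over ordered multi-indices of length `k` of `½(A (∂^α δρ)² + ρ ‖∂^α δu‖² + B (∂^α δθ)²)`,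
  outermost derivative = outermost sum);
* `ShadowWeakBootstrap` — the weak bootstrap regime on `[0, t₀]` (relative closeness of `ρ, θ`, packing
  bound, weighted `C¹` bounds of `δV` of Type-I size);
* `ShadowLevelBound E Q b` — the normalised conclusion `√E(s) ≤ σ³ Q (T₁/(T₁ − s))^b` on `[0, t₀]`;
* `ShadowSetting` — the common hypotheses of all levels (the level-`k` files conclude
  `ShadowLevelBound (shadowEk …) Q b …` from `ShadowSetting`, `ShadowWeakBootstrap` and the lower levels' bounds;
  the closing file consumes exactly these shapes); `shadowLevelBound_mono`.

Nothing is asserted here.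
-/

noncomputable section

namespace Summit.AtomisticToContinuum.HydrodynamicLimit.Theorems

open Set MeasureTheory
open Literature.MathematicalPhysics.KineticTheory Literature.Analysis.FunctionSpaces

/-- The Friedrichs weight of the density component at the σ-solution: `A = θ (ζ(ρ) + ρ ζ'(ρ)) / ρ`
(`= ∂_ρ p / ρ`). [folklore] -/
def shadowWeightA (ζ : ℝ → ℝ) (ρ θ : ℝ → T3 → ℝ) (s : ℝ) (x : T3) : ℝ :=
  θ s x * (ζ (ρ s x) + ρ s x * deriv ζ (ρ s x)) / ρ s x

/-- The Friedrichs weight of the temperature component at the σ-solution: `B = 3ρ/(2θ)`. [folklore] -/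
def shadowWeightB (ρ θ : ℝ → T3 → ℝ) (s : ℝ) (x : T3) : ℝ :=
  3 / 2 * ρ s x / θ s x

/-- Level-0 weighted energy `E₀(s) = ∫ ½(A δρ² + ρ |δu|² + B δθ²)` of the difference of the σ-solution
`(ρ, u, θ)` and the reference `(ρ₁, u₁, θ₁)`. [folklore] -/
def shadowE0 (ζ : ℝ → ℝ) (ρ θ : ℝ → T3 → ℝ) (u : ℝ → T3 → V3) (ρ₁ θ₁ : ℝ → T3 → ℝ)
    (u₁ : ℝ → T3 → V3) (s : ℝ) : ℝ :=
  ∫ x, 1 / 2 * (shadowWeightA ζ ρ θ s x * (ρ s x - ρ₁ s x) ^ 2 + ρ s x * ‖u s x - u₁ s x‖ ^ 2 +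
    shadowWeightB ρ θ s x * (θ s x - θ₁ s x) ^ 2)

/-- Level-1 weighted energy `E₁(s) = Σₗ ∫ ½(A (∂ₗδρ)² + ρ |∂ₗδu|² + B (∂ₗδθ)²)`. [folklore] -/
def shadowE1 (ζ : ℝ → ℝ) (ρ θ : ℝ → T3 → ℝ) (u : ℝ → T3 → V3) (ρ₁ θ₁ : ℝ → T3 → ℝ)
    (u₁ : ℝ → T3 → V3) (s : ℝ) : ℝ :=
  ∫ x, ∑ l : Fin 3, 1 / 2 * (shadowWeightA ζ ρ θ s x * (Torus.partialDeriv l (fun y => ρ s y - ρ₁ s y) x) ^ 2 +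
    ρ s x * ‖Torus.partialDeriv l (fun y => u s y - u₁ s y) x‖ ^ 2 +
    shadowWeightB ρ θ s x * (Torus.partialDeriv l (fun y => θ s y - θ₁ s y) x) ^ 2)

/-- Level-2 weighted energy `E₂(s) = Σᵢ Σₗ ∫ ½(A (∂ᵢ∂ₗδρ)² + ρ |∂ᵢ∂ₗδu|² + B (∂ᵢ∂ₗδθ)²)`. [folklore] -/
def shadowE2 (ζ : ℝ → ℝ) (ρ θ : ℝ → T3 → ℝ) (u : ℝ → T3 → V3) (ρ₁ θ₁ : ℝ → T3 → ℝ)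
    (u₁ : ℝ → T3 → V3) (s : ℝ) : ℝ :=
  ∫ x, ∑ i : Fin 3, ∑ l : Fin 3, 1 / 2 *
    (shadowWeightA ζ ρ θ s x *
        (Torus.partialDeriv i (Torus.partialDeriv l (fun y => ρ s y - ρ₁ s y)) x) ^ 2 +
      ρ s x * ‖Torus.partialDeriv i (Torus.partialDeriv l (fun y => u s y - u₁ s y)) x‖ ^ 2 +
      shadowWeightB ρ θ s x *
        (Torus.partialDeriv i (Torus.partialDeriv l (fun y => θ s y - θ₁ s y)) x) ^ 2)

/-- Level-3 weighted energy `E₃(s) = Σⱼ Σᵢ Σₗ ∫ ½(A (∂ⱼ∂ᵢ∂ₗδρ)² + ρ |∂ⱼ∂ᵢ∂ₗδu|² + B (∂ⱼ∂ᵢ∂ₗδθ)²)`.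
[folklore] -/
def shadowE3 (ζ : ℝ → ℝ) (ρ θ : ℝ → T3 → ℝ) (u : ℝ → T3 → V3) (ρ₁ θ₁ : ℝ → T3 → ℝ)
    (u₁ : ℝ → T3 → V3) (s : ℝ) : ℝ :=
  ∫ x, ∑ j : Fin 3, ∑ i : Fin 3, ∑ l : Fin 3, 1 / 2 *
    (shadowWeightA ζ ρ θ s x *
        (Torus.partialDeriv j (Torus.partialDeriv i (Torus.partialDeriv l (fun y => ρ s y - ρ₁ s y))) x) ^ 2 +
      ρ s x * ‖Torus.partialDeriv j (Torus.partialDeriv i (Torus.partialDeriv l (fun y => u s y - u₁ s y))) x‖ ^ 2 +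
      shadowWeightB ρ θ s x *
        (Torus.partialDeriv j (Torus.partialDeriv i (Torus.partialDeriv l (fun y => θ s y - θ₁ s y))) x) ^ 2)

/-- **The weak bootstrap regime on `[0, t₀]`** with constants `(Cb, ηs)` and horizon `T₁`: the
σ-solution stays within a factor of the reference (`|δρ| ≤ ρ₁/2`, `|δθ| ≤ θ₁/2`), the packing `ρσ³`
stays `≤ ηs`, and the first derivatives of `δV` obey the weighted Type-I-size bounds
`|∂ᵢδu|, √θ₁|∂ᵢδρ|/ρ₁, |∂ᵢδθ|/√θ₁ ≤ Cb/(T₁ − s)`. [folklore] -/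
def ShadowWeakBootstrap (Cb ηs T₁ σ : ℝ) (ρ θ : ℝ → T3 → ℝ) (u : ℝ → T3 → V3)
    (ρ₁ θ₁ : ℝ → T3 → ℝ) (u₁ : ℝ → T3 → V3) (t₀ : ℝ) : Prop :=
  (∀ s ∈ Icc 0 t₀, ∀ x, |ρ s x - ρ₁ s x| ≤ ρ₁ s x / 2 ∧ |θ s x - θ₁ s x| ≤ θ₁ s x / 2 ∧
      ρ s x * σ ^ 3 ≤ ηs) ∧
  (∀ s ∈ Icc 0 t₀, ∀ x, ∀ i : Fin 3,
      ‖Torus.partialDeriv i (u s) x - Torus.partialDeriv i (u₁ s) x‖ ≤ Cb / (T₁ - s) ∧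
      Real.sqrt (θ₁ s x) * |Torus.partialDeriv i (ρ s) x - Torus.partialDeriv i (ρ₁ s) x| / ρ₁ s x ≤
        Cb / (T₁ - s) ∧
      |Torus.partialDeriv i (θ s) x - Torus.partialDeriv i (θ₁ s) x| / Real.sqrt (θ₁ s x) ≤ Cb / (T₁ - s))

/-- **Normalised level bound on `[0, t₀]`**: `√E(s) ≤ σ³ Q (T₁/(T₁ − s))^b` for a level energy `E`
(one of `shadowE0 … shadowE3` applied to the fields). [folklore] -/
def ShadowLevelBound (E : ℝ → ℝ) (Q b T₁ σ t₀ : ℝ) : Prop :=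
  ∀ s ∈ Icc 0 t₀, Real.sqrt (E s) ≤ σ ^ 3 * Q * (T₁ / (T₁ - s)) ^ b

/-- **The common hypotheses of every level estimate** (structure, equation of state, reference, data),
bundled: `(ρ,u,θ)` is a classical σ-solution on `[0,T)` with law `ρθζ(ρ)` (`ζ` smooth on the open `J`
containing the densities) whose packing-proportional smallness `|ζ−1|, |ρζ'|, |ρ²ζ''| ≤ cZ·ρσ³` holds;
`(ρ₁,u₁,θ₁)` is the ideal-gas reference on `[0,T)`, `T ≤ T₁`, isentropic `θ₁ = Kρ₁^{2/3}`, Type I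
(`|∂u₁|, |∂ρ₁^{1/3}| ≤ C/(T₁−t)`), with polynomial sup bounds `Cpoly n (T₁−t)^{−ppoly n}` on the derivatives
of order `n ≤ 6` and the no-vacuum floor `cl (T₁−t)^{pl} ≤ ρ₁`; the data agree in `u, θ` and differ by
`O(σ³)` in `C⁶` in `ρ` (`Cstat`). [folklore] -/
def ShadowSetting (K C cZ T₁ cl pl : ℝ) (Cpoly ppoly Cstat : ℕ → ℝ) (σ T : ℝ) (ρ θ ρ₁ θ₁ : ℝ → T3 → ℝ)
    (u u₁ : ℝ → T3 → V3) (ζ : ℝ → ℝ) (J : Set ℝ) : Prop :=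
  IsHardSphereEulerSolution σ T ρ u θ ∧ IsHardSphereEulerSolution 0 T ρ₁ u₁ θ₁ ∧ 0 < σ ∧ σ ≤ 1 ∧ 0 < T ∧ T ≤ T₁ ∧
  IsOpen J ∧ ContDiffOn ℝ (⊤ : ℕ∞) ζ J ∧ (∀ t ∈ Ico 0 T, ∀ x, ρ t x ∈ J) ∧
  (∀ t ∈ Ico 0 T, ∀ x, hsPressure σ (ρ t x) (θ t x) = ρ t x * θ t x * ζ (ρ t x)) ∧
  (∀ t ∈ Ico 0 T, ∀ x, |ζ (ρ t x) - 1| ≤ cZ * (ρ t x * σ ^ 3) ∧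
    |ρ t x * deriv ζ (ρ t x)| ≤ cZ * (ρ t x * σ ^ 3) ∧
    |ρ t x ^ 2 * deriv (deriv ζ) (ρ t x)| ≤ cZ * (ρ t x * σ ^ 3)) ∧
  (∀ t ∈ Ico 0 T, ∀ x, θ₁ t x = K * ρ₁ t x ^ (2 / 3 : ℝ)) ∧
  (∀ t ∈ Ico 0 T, ∀ x, ∀ i : Fin 3, ‖Torus.partialDeriv i (u₁ t) x‖ ≤ C / (T₁ - t) ∧
    |Torus.partialDeriv i (fun y => ρ₁ t y ^ (1 / 3 : ℝ)) x| ≤ C / (T₁ - t)) ∧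
  (∀ n : ℕ, n ≤ 6 → ∀ t ∈ Ico 0 T, ∀ y : EuclideanSpace ℝ (Fin 3),
    ‖iteratedFDeriv ℝ n (Torus.lift (ρ₁ t)) y‖ ≤ Cpoly n * (T₁ - t) ^ (-ppoly n) ∧
    ‖iteratedFDeriv ℝ n (Torus.lift (u₁ t)) y‖ ≤ Cpoly n * (T₁ - t) ^ (-ppoly n)) ∧
  (∀ t ∈ Ico 0 T, ∀ x, cl * (T₁ - t) ^ pl ≤ ρ₁ t x) ∧
  u 0 = u₁ 0 ∧ θ 0 = θ₁ 0 ∧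
  (∀ n : ℕ, n ≤ 6 → ∀ y : EuclideanSpace ℝ (Fin 3),
    ‖iteratedFDeriv ℝ n (Torus.lift (fun x => ρ 0 x - ρ₁ 0 x)) y‖ ≤ Cstat n * σ ^ 3)

/-- Monotonicity of the normalised level bound in the constant `Q` (for `σ ≥ 0` and a base
`T₁/(T₁ - s) ≥ 0` on `[0, t₀]`). [folklore] -/
theorem shadowLevelBound_mono :
    ∀ {E : ℝ → ℝ} {Q Q' b T₁ σ t₀ : ℝ}, ShadowLevelBound E Q b T₁ σ t₀ → Q ≤ Q' → 0 ≤ σ →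
      (∀ s ∈ Icc 0 t₀, 0 ≤ T₁ / (T₁ - s)) → ShadowLevelBound E Q' b T₁ σ t₀ := by
  intro E Q Q' b T₁ σ t₀ h hQ hσ hbase s hs
  refine (h s hs).trans ?_
  have h1 : 0 ≤ (T₁ / (T₁ - s)) ^ b := Real.rpow_nonneg (hbase s hs) b
  have h2 : 0 ≤ σ ^ 3 := pow_nonneg hσ 3
  calc σ ^ 3 * Q * (T₁ / (T₁ - s)) ^ b = (σ ^ 3 * (T₁ / (T₁ - s)) ^ b) * Q := by ring
    _ ≤ (σ ^ 3 * (T₁ / (T₁ - s)) ^ b) * Q' := mul_le_mul_of_nonneg_left hQ (mul_nonneg h2 h1)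
    _ = σ ^ 3 * Q' * (T₁ / (T₁ - s)) ^ b := by ring

end Summit.AtomisticToContinuum.HydrodynamicLimit.Theorems

end
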